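import Summits.ResolutionOfSingularities.ResolutionOfSingularities.Theorems.PurelyInseparableDim4ResConeLevelTwoTriple
import HarnessLib
import HarnessLib.Audit.Tags

/-!
# Purely inseparable four-folds — the triple-merged level-2 ledger through a FREE-chart step
# (cell `res-dim4-pi`, K2(p) lane, slice B brick K22b)

[OURS · counted 0 · cell `res-dim4-pi` · K2(p) lane holder res-dim4-p-12 g3's brick by signature (bus
2026-08-29 00:46Z, SLICE-B-ARCH v1.6 K7 route A∞(T), input of res-dim4-p-2's K25 assembly), seat res-dim4-p-9 g3.]
Nothing here proves K2(p)/K2(5), `NoIsolatedTrap p p` or resolution of singularities in dimension ≥ 4 /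
characteristic `p`; bookkeeping of the light regime (I-4-7 class A∞) only.

Companion of `…ResConeLevelTwoTriple` (K22 (ii), the SELF-chart step): here the chart letter `x_j` is the FREE
fourth letter, the ledger letter `N` is translated away (it may carry `b_N ≠ 0`: LOST) and `μ, ν` are kept.
Under `σ_j ∘ shear`, `x_N ↦ x_j (x_N + b_N)`, `x_μ ↦ x_j x_μ`, `x_ν ↦ x_j x_ν`, so
`σ_j(x_N x_μ x_ν · S) = x_j^d · (x_j x_μ x_ν) · (x_N + b_N) · T_{d−2}(shear S)`: the triple-merged ledger
`u·G = S·(x_N x_μ x_ν) + T·h^d` becomes, on the NEW triple `{j, μ, ν}`,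
**`T₀u·G′ = S′·(x_j x_μ x_ν) + (U·T₀T)·(T₁h)^d`, `S′ ≡ U·(x_N + b_N)·chartTransform (d−2) (shear j b S)
(mod x_j x_μ x_ν)`** (`levelTwo_transport_triple_free`) — the lost letter leaves one more unit factor.

bears_on: LADDER-RESOLUTION:D157-DOOR2 (res-dim4-pi · K2(p) · slice B · K22b).  Supports
stmt-ResolutionOfSingularities-16155 (helper).
-/

set_option linter.dupNamespace false -- mandated namespace of this single-conjunct summit

noncomputable section

namespace Summit.ResolutionOfSingularities.ResolutionOfSingularities.Theorems.PIDim4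

namespace ResCone

open MvPolynomial Finset
open Literature.AlgebraicGeometry.Resolution
open Literature.AlgebraicGeometry.Resolution.CentreBlowup
open Literature.AlgebraicGeometry.Resolution.Hauser2010
open Literature.AlgebraicGeometry.Resolution.HauserPerlega2019

variable {K : Type} [Field K]

section Step

variable [DecidableEq K]

/-- **TRIPLE-MERGED TRANSPORT THROUGH A FREE CHART** (brick K22b; I-4-7 A∞): at the chart of a letter `x_j`
outside the triple `{N, μ, ν}` of a triple ledger `u·G = S·(x_N x_μ x_ν) + T·h^d` (`h ∈ 𝔪₀`, `ord S ≥ d − 2`,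
`d = o − |r| ≥ 2`), with `μ ≠ ν` kept (`b_μ = b_ν = 0`, `1 ≤ r_μ, r_ν ≤ q − 2`), `q < ord₀ F = o ≤ 2q − 2` and
`N` arbitrary (translated or not), the new residual satisfies
`T₀u·G′ = S′·(x_j x_μ x_ν) + (U·T₀T)·(T₁h)^d` with `S′ ≡ U·(x_N + b_N)·chartTransform (d−2) (shear j b S)
(mod x_j x_μ x_ν)`. [OURS] [cite: CossartJannsenSaito2020, Thm. 3.10(4), Thm. 9.3] -/
theorem levelTwo_transport_triple_free {q : ℕ} (j : Fin 4) {b : Fin 4 → K} (hbj : b j = 0) {s : State K}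
    {o : ℕ} (ho : ordZero s.F = o) (hr : ∀ d ∈ s.F.support, s.r ≤ d) (hqo : q < o) (ho2 : o + 2 ≤ 2 * q)
    {N μ ν : Fin 4} (hjN : j ≠ N) (hjμ : j ≠ μ) (hjν : j ≠ ν) (hμν : μ ≠ ν) (hbμ : b μ = 0) (hbν : b ν = 0)
    (hrμ : 1 ≤ s.r μ) (hrμq : s.r μ + 2 ≤ q) (hrν : 1 ≤ s.r ν) (hrνq : s.r ν + 2 ≤ q)
    (hd2 : 2 ≤ o - s.r.degree) {h u S T : MvPolynomial (Fin 4) K} (hh : h ∈ originIdeal K)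
    (hG : u * s.F.divMonomial s.r = S * (X N * X μ * X ν) + T * h ^ (o - s.r.degree))
    (hS : ∀ m ∈ S.support, o - s.r.degree - 2 ≤ m.degree) :
    ∃ S' : MvPolynomial (Fin 4) K,
      chartTransform 0 Finset.univ j (shear j b u) *
          ((CentreBlowup.step q Finset.univ j b s).F.divMonomial (CentreBlowup.step q Finset.univ j b s).r) =
        S' * (X j * X μ * X ν) +
          ((∏ i ∈ Finset.univ.filter (fun i => b i ≠ 0), (X i + C (b i)) ^ (s.r i)) *
            chartTransform 0 Finset.univ j (shear j b T)) *
            chartTransform 1 Finset.univ j (shear j b h) ^ (o - s.r.degree) ∧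
      S' - (∏ i ∈ Finset.univ.filter (fun i => b i ≠ 0), (X i + C (b i)) ^ (s.r i)) * (X N + C (b N)) *
          chartTransform (o - s.r.degree - 2) Finset.univ j (shear j b S) ∈
        Ideal.span {(X j * X μ * X ν : MvPolynomial (Fin 4) K)} := by
  set d := o - s.r.degree with hd
  set G := s.F.divMonomial s.r with hGdef
  set r' := (CentreBlowup.step q Finset.univ j b s).r with hr'
  set G' := (CentreBlowup.step q Finset.univ j b s).F.divMonomial r' with hG'def
  set U0 : MvPolynomial (Fin 4) K :=
    ∏ i ∈ Finset.univ.filter (fun i => b i ≠ 0), (X i + C (b i)) ^ (s.r i) with hU0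
  -- (i) the deleted part is `(x_j x_μ x_ν)² · c`
  obtain ⟨c, hc⟩ := Ideal.mem_span_singleton.mp
    (deleted_mem_span_sq_triple j hbj ho hr hqo ho2 hjμ hjν hμν hbμ hbν hrμ hrμq hrν hrνq)
  -- degrees
  have hGdeg : ∀ e ∈ G.support, d ≤ e.degree := forall_le_degree_divMonomial ho
  have huG : ∀ e ∈ (u * G).support, d ≤ e.degree := by
    have h1 := forall_le_degree_mul (fun _ _ => Nat.zero_le _) hGdeg (P := u)
    simpa only [Nat.zero_add] using h1
  have hh1 : ∀ e ∈ h.support, 1 ≤ e.degree := forall_one_le_degree_of_mem_originIdeal hh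
  -- (ii) the transform of the ledger identity:
  -- `T_d(uG) = x_j x_μ x_ν · (x_N + b_N) · T_{d−2}S + T₀T · (T₁h)^d`
  have hshear : shear j b (u * G) =
      shear j b S * ((X N + C (b N) * X j) * X μ * X ν) + shear j b T * shear j b h ^ d := by
    rw [hGdef, hG]
    unfold shear
    simp only [map_add, map_mul, map_pow, aeval_X, if_neg hjN.symm, if_neg hjμ.symm, if_neg hjν.symm, hbμ, hbν,
      C_0, zero_mul, add_zero]
  have key : chartTransform d Finset.univ j (shear j b (u * G)) =
      (X j * X μ * X ν) * (X N + C (b N)) * chartTransform (d - 2) Finset.univ j (shear j b S) +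
        chartTransform 0 Finset.univ j (shear j b T) * chartTransform 1 Finset.univ j (shear j b h) ^ d := by
    apply mul_left_cancel₀ (pow_ne_zero d (X_ne_zero j))
    rw [X_pow_mul_chartTransform_univ j (forall_le_degree_shear j b huG), hshear, map_add, map_mul, map_mul,
      map_mul, map_mul, map_pow, map_add, map_mul, coordBlowupSubst_C,
      ← X_pow_mul_chartTransform_univ j (forall_le_degree_shear j b hS),
      ← X_pow_mul_chartTransform_univ j (forall_le_degree_shear j b hh1),
      ← X_pow_mul_chartTransform_univ j (fun _ _ => Nat.zero_le _) (m := 0) (P := shear j b T),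
      coordBlowupSubst_X_self,
      coordBlowupSubst_X_of_mem_of_ne K _ j (Finset.mem_coe.mpr (Finset.mem_univ N)) hjN.symm,
      coordBlowupSubst_X_of_mem_of_ne K _ j (Finset.mem_coe.mpr (Finset.mem_univ μ)) hjμ.symm,
      coordBlowupSubst_X_of_mem_of_ne K _ j (Finset.mem_coe.mpr (Finset.mem_univ ν)) hjν.symm, pow_one,
      mul_pow, pow_zero, one_mul,
      show (X j : MvPolynomial (Fin 4) K) ^ d = X j ^ (d - 2) * X j * X j by
        rw [mul_assoc, ← pow_two, ← pow_add, Nat.sub_add_cancel hd2]]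
    ring
  -- (iii) `T₀u · T_dG = T_d(uG)`
  have hprod : chartTransform 0 Finset.univ j (shear j b u) * chartTransform d Finset.univ j (shear j b G) =
      chartTransform d Finset.univ j (shear j b (u * G)) := by
    rw [shear_mul, ← chartTransform_mul j (fun _ _ => Nat.zero_le _) (forall_le_degree_shear j b hGdeg),
      Nat.zero_add]
  -- (iv) the cleaned new residual (K5(a))
  have hG' : G' = U0 * chartTransform d Finset.univ j (shear j b G) - (X j * X μ * X ν) ^ 2 * c := by
    rw [← hc]; exact eq_sub_of_add_eq (divMonomial_step_F_add_deleted j hbj ho hr hqo.le)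
  refine ⟨U0 * (X N + C (b N)) * chartTransform (d - 2) Finset.univ j (shear j b S) -
    chartTransform 0 Finset.univ j (shear j b u) * (X j * X μ * X ν) * c, ?_, ?_⟩
  · rw [hG', mul_sub, mul_left_comm, hprod, key]
    ring
  · rw [sub_sub_cancel_left]
    exact Submodule.neg_mem _ (Ideal.mul_mem_right _ _ (Ideal.mul_mem_left _ _ (Ideal.subset_span rfl)))

end Step

end ResCone

end Summit.ResolutionOfSingularities.ResolutionOfSingularities.Theorems.PIDim4
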